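import Literature.Combinatorics.SimpleGraph.ReducedDivisors
import HarnessLib

/-!
# The divisors `ν_P` of the linear orders of `V(G)`: `deg ν_P = g − 1`, `|ν_P| = ∅`,
# `ν_P + ν_{P̄} = K`, and Baker–Norine's Theorem 3.3: for every `D` exactly one of `r(D) ≥ 0`,
# `r(ν_P − D) ≥ 0` for some order `P` (Baker–Norine 2007, Lemma 3.2, Theorem 3.3, Corollary 3.4)

Source (held, read at the page; statements VERBATIM). M. Baker, S. Norine, *Riemann–Roch and
Abel–Jacobi theory on a finite graph*, Adv. Math. 215 (2007) 766–788 [BakerNorine2007], §3.2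
«Proof of the Riemann–Roch theorem» (held text `paper:doi-10-1016-j-aim-2007-04-012` pp. 14–16):
«For each linear (i.e., total) order `<_P` on `V(G)`, we define
`ν_P = Σ_{v ∈ V(G)} (|{e = vw ∈ E(G) : w <_P v}| − 1)(v)`. It is clear that
`deg(ν_P) = |E(G)| − |V(G)| = g − 1`. **Lemma 3.2.** For every linear order `<_P` on `V(G)` we
have `ν_P ∈ 𝒩`. **Proof.** Let `D ∈ Div(G)` be any divisor of the form `D = ν_P − Δ(f)` for some
`f ∈ 𝓜(G)`. Let `V_f^max` be the set of vertices `v ∈ G` at which `f` achieves its maximum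
value, and let `u` be the minimal element of `V_f^max` with respect to the order `<_P`. Then
`f(w) ≤ f(u)` for all `w ∈ V(G)`, and if `w <_P u` then `f(w) < f(u)`. Thus
`D(u) = (|{e = uw ∈ E(G) : w <_P u}| − 1) − Σ_{e = uw ∈ E(G)} (f(u) − f(w)) […] ≤ −1`, since each
term in these sums is non-positive by the choice of `u`. It follows that `ν_P` is not equivalent
to any effective divisor. **Theorem 3.3.** For every `D ∈ Div(G)`, exactly one of the following
holds (N1) `r(D) ≥ 0`; or (N2) `r(ν_P − D) ≥ 0` for some order `<_P` on `V(G)`. **Proof.** Choose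
`v₀ ∈ V(G)`. By Proposition 3.1, we may assume that `D` is `v₀`-reduced. We define
`v₁, v₂, …, v_{|V(G)|−1}` inductively as follows. If `v₀, v₁, …, v_{k−1}` are defined, let
`A_k = V(G) − {v₀, v₁, …, v_{k−1}}`, and let `v_k ∈ A_k` be chosen so that
`D(v_k) < outdeg_{A_k}(v_k)`. Let `<_P` be the linear order on `V(G)` such that `v_i <_P v_j` if
and only if `i < j`. For every `1 ≤ k ≤ |V(G)| − 1` we have
`D(v_k) ≤ outdeg_{A_k}(v_k) − 1 = |{e = v_k v_j ∈ E(G) : j < k}| − 1 = ν_P(v_k)`. If `D(v₀) ≥ 0`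
then we have `D ≥ 0` and (N1) holds. If, on the other hand, `D(v₀) ≤ −1` then `D ≤ ν_P` and
(N2) holds. Finally, note that if `r(D) ≥ 0` and `r(ν_P − D) ≥ 0`, then `r(ν_P) ≥ 0` by
Lemma 2.1, contradicting Lemma 3.2. **Corollary 3.4.** For `D ∈ Div(G)` with `deg(D) = g − 1` we
have `D ∈ 𝒩` if and only if there exists a linear order `<_P` on `V(G)` such that `D ∼ ν_P`.
[…] (proof of Theorem 1.12) Let `P̄` be the reverse of `P` […] Then for every `v ∈ V(G)`, we
have `ν_P(v) + ν_{P̄}(v) = […] = deg(v) − 2 = K(v)`.» Here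
`𝒩 = {D ∈ Div(X) : deg(D) = g − 1 and |D| = ∅}` (§2). §1.5, **Theorem 1.9** (2): «If
`N ≤ g − 1`, then there is always an initial configuration for which no winning strategy exists.»

## What is formalised (vocabulary of `GraphDivisors` / `ReducedDivisors`)

Linear orders `<_P` on the finite vertex set are encoded by RANKINGS `ρ : V → ℕ`
(`w <_P v` iff `ρ w < ρ v`); the linear orders are exactly the injective rankings (up to the
order they induce), and the reverse order `P̄` is the ranking `revRank ρ = (Σ ρ) − ρ`.

* `orderDivisor G ρ` (`ν_P(v) = |{e = vw : w <_P v}| − 1`); `neg_one_le_orderDivisor`,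
  `orderDivisor_le`; **`sum_orderDivisor`** («`deg(ν_P) = |E(G)| − |V(G)| = g − 1`», `ρ`
  injective), through `card_filter_lt_add_card_filter_gt` and a dart-swap lemma; the reverse order **`orderDivisor_revRank`** («`ν_P + ν_{P̄} = K`»),
  `revRank_injective`;
* **Lemma 3.2** `not_winnable_orderDivisor` (`|ν_P| = ∅`, for EVERY ranking `ρ`, B–N's
  minimal-element-of-the-argmax proof), `rank_orderDivisor` (`r(ν_P) = −1`);
* the inductive construction of the proof of Theorem 3.3: **`IsReduced.exists_le_orderDivisor`**
  (a `q`-reduced divisor in debt at `q` satisfies `D ≤ ν_P` for some linear order — the vertices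
  are listed one at a time, each new `v_k` with `D(v_k) < outdeg_{A_k}(v_k)`);
* **Theorem 3.3** `winnable_or_exists_winnable_orderDivisor_sub` ((N1) or (N2), `G` connected)
  and `Winnable.not_winnable_orderDivisor_sub` (not both), with the rank forms
  `rank_nonneg_or_exists` / `rank_orderDivisor_sub_eq_neg_one`;
* **Corollary 3.4** `not_winnable_iff_exists_linEquiv_orderDivisor` (a divisor of degree `g − 1`
  has `|D| = ∅` iff `D ∼ ν_P` for some linear order);
* **Theorem 1.9 (2)** `exists_not_winnable_of_le` (for every `N ≤ g − 1` some divisor of degree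
  `N` has no winning strategy: `ν_P − E`).

Definitions with bodies and theorems; no `sorry`; no named facts.
-/

open Finset SimpleGraph Matrix
open Literature.Combinatorics.SimpleGraph.ChipFiring

namespace Literature.Combinatorics.SimpleGraph.BakerNorine

variable {V : Type*} [Fintype V] [DecidableEq V] (G : SimpleGraph V) [DecidableRel G.Adj]

/-! ### §1 The divisor `ν_P` of a linear order -/

section OrderDivisor

omit [DecidableEq V] in
/-- **`ν_P`** for the order `w <_P v ⟺ ρ w < ρ v` given by a ranking `ρ : V → ℕ`:
«`ν_P = Σ_{v ∈ V(G)} (|{e = vw ∈ E(G) : w <_P v}| − 1)(v)`».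
[cite: BakerNorine2007, §3.2 (before Lemma 3.2)] -/
def orderDivisor (ρ : V → ℕ) : V → ℤ := fun v => (#{w ∈ G.neighborFinset v | ρ w < ρ v} : ℤ) - 1

omit [DecidableEq V] in
/-- Unfolding `ν_P`. [cite: BakerNorine2007, §3.2] -/
theorem orderDivisor_apply (ρ : V → ℕ) (v : V) :
    orderDivisor G ρ v = (#{w ∈ G.neighborFinset v | ρ w < ρ v} : ℤ) - 1 := rfl

omit [DecidableEq V] in
/-- `ν_P(v) ≥ −1`. [cite: BakerNorine2007, §3.2] -/
theorem neg_one_le_orderDivisor (ρ : V → ℕ) (v : V) : -1 ≤ orderDivisor G ρ v := by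
  rw [orderDivisor_apply]
  linarith [Nat.cast_nonneg (α := ℤ) #{w ∈ G.neighborFinset v | ρ w < ρ v}]

omit [DecidableEq V] in
/-- `ν_P(v) ≤ deg(v) − 1`. [cite: BakerNorine2007, §3.2] -/
theorem orderDivisor_le (ρ : V → ℕ) (v : V) : orderDivisor G ρ v ≤ G.degree v - 1 := by
  rw [orderDivisor_apply, ← card_neighborFinset_eq_degree]
  have := Finset.card_filter_le (G.neighborFinset v) (fun w => ρ w < ρ v)
  omega

omit [DecidableEq V] in
/-- Swapping the roles of the two ends of each edge in a double sum over adjacent pairs.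
[folklore] -/
private theorem sum_neighborFinset_comm {β : Type*} [AddCommMonoid β] (f : V → V → β) :
    ∑ v, ∑ w ∈ G.neighborFinset v, f v w = ∑ v, ∑ w ∈ G.neighborFinset v, f w v := by
  have key : ∀ g : V → V → β,
      ∑ v, ∑ w ∈ G.neighborFinset v, g v w = ∑ v, ∑ w, if G.Adj v w then g v w else 0 := by
    intro g
    refine Finset.sum_congr rfl fun v _ => ?_
    rw [neighborFinset_eq_filter, Finset.sum_filter]
  rw [key, key, Finset.sum_comm]
  refine Finset.sum_congr rfl fun a _ => Finset.sum_congr rfl fun b _ => ?_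
  by_cases h : G.Adj b a
  · rw [if_pos h, if_pos h.symm]
  · rw [if_neg h, if_neg fun h' => h h'.symm]

omit [DecidableEq V] in
/-- For a linear order every neighbour of `v` is either before or after `v`:
`|{w ∼ v : w <_P v}| + |{w ∼ v : v <_P w}| = deg(v)`.
[cite: BakerNorine2007, Theorem 1.12 (proof: «`ν_P(v) + ν_{P̄}(v) = deg(v) − 2`»)] -/
theorem card_filter_lt_add_card_filter_gt {ρ : V → ℕ} (hρ : Function.Injective ρ) (v : V) :
    #{w ∈ G.neighborFinset v | ρ w < ρ v} + #{w ∈ G.neighborFinset v | ρ v < ρ w} = G.degree v := by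
  rw [← card_neighborFinset_eq_degree,
    ← Finset.card_filter_add_card_filter_not (s := G.neighborFinset v) (fun w => ρ w < ρ v)]
  congr 1
  refine congrArg _ (Finset.filter_congr fun w hw => ?_)
  have hne : ρ w ≠ ρ v := fun h => G.ne_of_adj ((mem_neighborFinset G v w).1 hw) (hρ h).symm
  omega

omit [DecidableEq V] in
/-- Every edge is counted once at its later end: `Σ_v |{w ∼ v : w <_P v}| = |E(G)|`.
[cite: BakerNorine2007, §3.2 («It is clear that `deg(ν_P) = |E(G)| − |V(G)|`»)] -/
theorem sum_card_filter_lt {ρ : V → ℕ} (hρ : Function.Injective ρ) :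
    ∑ v, #{w ∈ G.neighborFinset v | ρ w < ρ v} = #G.edgeFinset := by
  have hswap : ∑ v, #{w ∈ G.neighborFinset v | ρ w < ρ v} = ∑ v, #{w ∈ G.neighborFinset v | ρ v < ρ w} := by
    simp only [Finset.card_filter]
    exact sum_neighborFinset_comm G (fun v w => if ρ w < ρ v then 1 else 0)
  have hsum : ∑ v, #{w ∈ G.neighborFinset v | ρ w < ρ v} + ∑ v, #{w ∈ G.neighborFinset v | ρ v < ρ w}
      = 2 * #G.edgeFinset := by
    rw [← Finset.sum_add_distrib, ← G.sum_degrees_eq_twice_card_edges]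
    exact Finset.sum_congr rfl fun v _ => card_filter_lt_add_card_filter_gt G hρ v
  omega

omit [DecidableEq V] in
/-- **«`deg(ν_P) = |E(G)| − |V(G)| = g − 1`.»** [cite: BakerNorine2007, §3.2] -/
theorem sum_orderDivisor {ρ : V → ℕ} (hρ : Function.Injective ρ) :
    ∑ v, orderDivisor G ρ v = genus G - 1 := by
  simp only [orderDivisor_apply, Finset.sum_sub_distrib, Finset.sum_const, Finset.card_univ]
  rw [← Nat.cast_sum, sum_card_filter_lt G hρ, genus_eq]
  ring

omit [DecidableEq V] in
/-- The **reverse order** `P̄` («`v <_P w ⇔ w <_{P̄} v`») as a ranking. [cite: BakerNorine2007,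
Theorem 1.12 (proof)] -/
def revRank (ρ : V → ℕ) : V → ℕ := fun v => (∑ u, ρ u) - ρ v

omit [DecidableEq V] in
/-- Unfolding `revRank`. [cite: BakerNorine2007, Theorem 1.12 (proof)] -/
theorem revRank_apply (ρ : V → ℕ) (v : V) : revRank ρ v = (∑ u, ρ u) - ρ v := rfl

omit [DecidableEq V] in
/-- «`v <_P w ⇔ w <_{P̄} v`». [cite: BakerNorine2007, Theorem 1.12 (proof)] -/
theorem revRank_lt_revRank_iff (ρ : V → ℕ) (v w : V) : revRank ρ w < revRank ρ v ↔ ρ v < ρ w := by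
  rw [revRank_apply, revRank_apply]
  have hv : ρ v ≤ ∑ u, ρ u := Finset.single_le_sum (fun u _ => Nat.zero_le (ρ u)) (mem_univ v)
  have hw : ρ w ≤ ∑ u, ρ u := Finset.single_le_sum (fun u _ => Nat.zero_le (ρ u)) (mem_univ w)
  omega

omit [DecidableEq V] in
/-- The reverse of a linear order is a linear order. [cite: BakerNorine2007, Theorem 1.12 (proof)] -/
theorem revRank_injective {ρ : V → ℕ} (hρ : Function.Injective ρ) : Function.Injective (revRank ρ) := by
  intro v w h
  rw [revRank_apply, revRank_apply] at h
  have hv : ρ v ≤ ∑ u, ρ u := Finset.single_le_sum (fun u _ => Nat.zero_le (ρ u)) (mem_univ v)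
  have hw : ρ w ≤ ∑ u, ρ u := Finset.single_le_sum (fun u _ => Nat.zero_le (ρ u)) (mem_univ w)
  exact hρ (by omega)

omit [DecidableEq V] in
/-- **«`ν_P(v) + ν_{P̄}(v) = […] = deg(v) − 2 = K(v)`»**: `ν_{P̄} = K − ν_P`.
[cite: BakerNorine2007, Theorem 1.12 (proof, (RR2))] -/
theorem orderDivisor_revRank {ρ : V → ℕ} (hρ : Function.Injective ρ) :
    orderDivisor G (revRank ρ) = canonicalDivisor G - orderDivisor G ρ := by
  funext v
  rw [Pi.sub_apply, orderDivisor_apply, orderDivisor_apply, canonicalDivisor_apply]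
  have h1 : #{w ∈ G.neighborFinset v | revRank ρ w < revRank ρ v}
      = #{w ∈ G.neighborFinset v | ρ v < ρ w} :=
    congrArg _ (Finset.filter_congr fun w _ => revRank_lt_revRank_iff ρ v w)
  have h2 := card_filter_lt_add_card_filter_gt G hρ v
  rw [h1]
  omega

end OrderDivisor

/-! ### §2 Lemma 3.2: `|ν_P| = ∅` -/

section NonSpecial

/-- **Lemma 3.2.** «For every linear order `<_P` on `V(G)` we have `ν_P ∈ 𝒩`», i.e. «`ν_P` is
not equivalent to any effective divisor» — for `D = ν_P − Δ(f)` and `u` the `<_P`-minimal vertex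
at which `f` is maximal, `D(u) ≤ −1`. (Holds for every ranking `ρ`, injective or not.)
[cite: BakerNorine2007, Lemma 3.2] -/
theorem not_winnable_orderDivisor [Nonempty V] (ρ : V → ℕ) : ¬Winnable G (orderDivisor G ρ) := by
  rintro ⟨E, hE, hνE⟩
  obtain ⟨f, rfl⟩ := (linEquiv_iff_exists_eq_sub G _ _).1 hνE
  -- `u`: among the vertices where `f` is maximal, one of least rank
  obtain ⟨u₀, -, hu₀⟩ := Finset.exists_max_image univ f univ_nonempty
  set M := univ.filter (fun v => f v = f u₀) with hM
  obtain ⟨u, huM, hu⟩ := Finset.exists_min_image M ρ ⟨u₀, by simp [hM]⟩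
  have hfu : f u = f u₀ := (Finset.mem_filter.1 huM).2
  have h0 := hE u
  rw [Pi.zero_apply, Pi.sub_apply, orderDivisor_apply, lapMatrix_mulVec_apply_eq_sum_sub] at h0
  -- «if `w <_P u` then `f(w) < f(u)`»: `Σ_{w ∼ u} (f(u) − f(w)) ≥ |{w ∼ u : w <_P u}|`
  have hsum : (#{w ∈ G.neighborFinset u | ρ w < ρ u} : ℤ) ≤ ∑ w ∈ G.neighborFinset u, (f u - f w) := by
    calc (#{w ∈ G.neighborFinset u | ρ w < ρ u} : ℤ)
        = ∑ w ∈ {w ∈ G.neighborFinset u | ρ w < ρ u}, (1 : ℤ) := by simp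
      _ ≤ ∑ w ∈ {w ∈ G.neighborFinset u | ρ w < ρ u}, (f u - f w) :=
          Finset.sum_le_sum fun w hw => by
            have hlt := (Finset.mem_filter.1 hw).2
            have hwM : w ∉ M := fun h => by have := hu w h; omega
            have hfw : f w ≠ f u₀ := by simpa [hM] using hwM
            have h1 := hu₀ w (mem_univ w)
            omega
      _ ≤ ∑ w ∈ G.neighborFinset u, (f u - f w) :=
          Finset.sum_le_sum_of_subset_of_nonneg (Finset.filter_subset _ _) fun w _ _ => by
            have h1 := hu₀ w (mem_univ w)
            omega
  linarith

/-- `r(ν_P) = −1`. [cite: BakerNorine2007, Lemma 3.2] -/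
theorem rank_orderDivisor [Nonempty V] (ρ : V → ℕ) : rank G (orderDivisor G ρ) = -1 :=
  (rank_eq_neg_one_iff G _).2 (not_winnable_orderDivisor G ρ)

variable {G} in
/-- «if `r(D) ≥ 0` and `r(ν_P − D) ≥ 0`, then `r(ν_P) ≥ 0` by Lemma 2.1, contradicting
Lemma 3.2»: (N1) and (N2) never hold together. [cite: BakerNorine2007, Theorem 3.3 (proof)] -/
theorem Winnable.not_winnable_orderDivisor_sub [Nonempty V] {D : V → ℤ} (hD : Winnable G D)
    (ρ : V → ℕ) : ¬Winnable G (orderDivisor G ρ - D) := fun h => by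
  have := hD.add h
  rw [add_sub_cancel] at this
  exact not_winnable_orderDivisor G ρ this

end NonSpecial

/-! ### §3 The construction in the proof of Theorem 3.3 -/

section Construction

variable {G}

omit [Fintype V] in
/-- Appending a new vertex to the list leaves «the vertices before `v`» unchanged for a listed
`v`. [folklore] -/
private theorem filter_idxOf_append_of_mem {π : List V} {u v : V} (hv : v ∈ π) (s : Finset V) :
    {w ∈ s | (π ++ [u]).idxOf w < (π ++ [u]).idxOf v} = {w ∈ s | π.idxOf w < π.idxOf v} := by
  refine Finset.filter_congr fun w _ => ?_
  rw [List.idxOf_append_of_mem hv]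
  by_cases hw : w ∈ π
  · rw [List.idxOf_append_of_mem hw]
  · rw [List.idxOf_append_of_notMem hw, List.idxOf_of_notMem hw]
    have := List.idxOf_lt_length_of_mem hv
    constructor <;> intro h <;> omega

omit [Fintype V] in
/-- For the newly appended vertex, «the vertices before it» are the listed ones. [folklore] -/
private theorem filter_idxOf_append_self {π : List V} {u : V} (hu : u ∉ π) (s : Finset V) :
    {w ∈ s | (π ++ [u]).idxOf w < (π ++ [u]).idxOf u} = {w ∈ s | w ∈ π} := by
  refine Finset.filter_congr fun w _ => ?_
  rw [List.idxOf_append_of_notMem hu, List.idxOf_cons_self, add_zero]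
  by_cases hw : w ∈ π
  · rw [List.idxOf_append_of_mem hw]
    exact ⟨fun _ => hw, fun _ => List.idxOf_lt_length_of_mem hw⟩
  · rw [List.idxOf_append_of_notMem hw]
    constructor
    · intro h
      omega
    · intro h
      exact absurd h hw

/-- The induction of the proof of Theorem 3.3: «If `v₀, v₁, …, v_{k−1}` are defined, let
`A_k = V(G) − {v₀, …, v_{k−1}}`, and let `v_k ∈ A_k` be chosen so that
`D(v_k) < outdeg_{A_k}(v_k)`» — run until every vertex is listed, keeping
`D(v_k) + 1 ≤ |{e = v_k v_j : j < k}|` for the listed `v_k ≠ v₀`.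
[cite: BakerNorine2007, Theorem 3.3 (proof)] -/
private theorem exists_list_aux {q : V} {D : V → ℤ} (hD : IsReduced G q D) :
    ∀ (m : ℕ) (π : List V), π.Nodup → q ∈ π →
      (∀ v ∈ π, v ≠ q → D v + 1 ≤ #{w ∈ G.neighborFinset v | π.idxOf w < π.idxOf v}) →
      #(univ.filter (fun v => v ∉ π)) = m →
      ∃ π' : List V, π'.Nodup ∧ (∀ v, v ∈ π') ∧
        ∀ v ∈ π', v ≠ q → D v + 1 ≤ #{w ∈ G.neighborFinset v | π'.idxOf w < π'.idxOf v} := by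
  intro m
  induction m with
  | zero =>
    intro π hnd hq hinv hcard
    refine ⟨π, hnd, fun v => ?_, hinv⟩
    by_contra hv
    have hmem : v ∈ univ.filter (fun v => v ∉ π) := by simp [hv]
    rw [Finset.card_eq_zero] at hcard
    rw [hcard] at hmem
    exact absurd hmem (Finset.notMem_empty v)
  | succ m ih =>
    intro π hnd hq hinv hcard
    -- the unlisted vertices `A` form a non-empty set avoiding `q`
    set A := univ.filter (fun v => v ∉ π) with hA
    have hAne : A.Nonempty := Finset.card_pos.1 (by omega)
    have hqA : q ∉ A := by simp [hA, hq]
    obtain ⟨u, huA, hu⟩ := hD.2 A hAne hqA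
    have huπ : u ∉ π := (Finset.mem_filter.1 huA).2
    have hsd : G.neighborFinset u \ A = {w ∈ G.neighborFinset u | w ∈ π} := by
      ext w
      simp [hA]
    rw [hsd] at hu
    refine ih (π ++ [u]) ?_ ?_ ?_ ?_
    · rw [List.nodup_append_comm, List.singleton_append]
      exact List.nodup_cons.2 ⟨huπ, hnd⟩
    · exact List.mem_append.2 (Or.inl hq)
    · intro v hv hvq
      rw [List.mem_append, List.mem_singleton] at hv
      rcases hv with hv | rfl
      · rw [filter_idxOf_append_of_mem hv]
        exact hinv v hv hvq
      · rw [filter_idxOf_append_self huπ]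
        omega
    · have hset : univ.filter (fun v => v ∉ π ++ [u]) = A.erase u := by
        ext w
        simp only [hA, Finset.mem_filter, Finset.mem_univ, true_and, List.mem_append,
          List.mem_singleton, not_or, Finset.mem_erase]
        tauto
      rw [hset, Finset.card_erase_of_mem huA, hcard]
      rfl

/-- **The order built in the proof of Theorem 3.3**: a `v₀`-reduced divisor with `D(v₀) ≤ −1`
satisfies «`D ≤ ν_P`» for a linear order `<_P` starting at `v₀` («For every
`1 ≤ k ≤ |V(G)| − 1` we have `D(v_k) ≤ outdeg_{A_k}(v_k) − 1 = |{e = v_k v_j ∈ E(G) : j < k}| − 1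
= ν_P(v_k)`»). [cite: BakerNorine2007, Theorem 3.3 (proof)] -/
theorem IsReduced.exists_le_orderDivisor {q : V} {D : V → ℤ} (hD : IsReduced G q D) (hq : D q < 0) :
    ∃ ρ : V → ℕ, Function.Injective ρ ∧ D ≤ orderDivisor G ρ := by
  obtain ⟨π, hnd, hcov, hinv⟩ := exists_list_aux hD _ [q] (List.nodup_singleton q)
    (List.mem_singleton_self q) (fun v hv hvq => absurd (List.mem_singleton.1 hv) hvq) rfl
  refine ⟨fun v => π.idxOf v, fun v w h => (List.idxOf_inj (hcov v)).1 h, fun v => ?_⟩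
  by_cases hvq : v = q
  · rw [hvq]
    exact (Int.le_sub_one_of_lt hq).trans (by
      have := neg_one_le_orderDivisor G (fun v => π.idxOf v) q
      omega)
  · have := hinv v (hcov v) hvq
    show D v ≤ (#{w ∈ G.neighborFinset v | π.idxOf w < π.idxOf v} : ℤ) - 1
    linarith

end Construction

/-! ### §4 Theorem 3.3 and Corollary 3.4 -/

section MainTheorem

variable {G}

/-- **Theorem 3.3 (existence half).** «For every `D ∈ Div(G)` […] (N1) `r(D) ≥ 0`; or (N2)
`r(ν_P − D) ≥ 0` for some order `<_P` on `V(G)`» — at least one holds (`G` connected: reduce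
`D` at a base vertex; «If `D(v₀) ≥ 0` then we have `D ≥ 0` and (N1) holds. If, on the other
hand, `D(v₀) ≤ −1` then `D ≤ ν_P` and (N2) holds»). [cite: BakerNorine2007, Theorem 3.3] -/
theorem winnable_or_exists_winnable_orderDivisor_sub (hG : G.Connected) (D : V → ℤ) :
    Winnable G D ∨ ∃ ρ : V → ℕ, Function.Injective ρ ∧ Winnable G (orderDivisor G ρ - D) := by
  obtain ⟨q⟩ := hG.nonempty
  obtain ⟨D', hDD', hD'⟩ := exists_isReduced hG q D
  by_cases hq : 0 ≤ D' q
  · exact Or.inl (hDD'.symm.winnable (hD'.winnable_iff.2 hq))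
  · obtain ⟨ρ, hρ, hle⟩ := hD'.exists_le_orderDivisor (by omega)
    refine Or.inr ⟨ρ, hρ, (hDD'.sub_left (orderDivisor G ρ)).symm.winnable ?_⟩
    exact winnable_of_nonneg G fun v => sub_nonneg.2 (hle v)

/-- **Theorem 3.3.** «For every `D ∈ Div(G)`, exactly one of the following holds (N1)
`r(D) ≥ 0`; or (N2) `r(ν_P − D) ≥ 0` for some order `<_P` on `V(G)`» (`G` connected).
[cite: BakerNorine2007, Theorem 3.3] -/
theorem rank_nonneg_or_exists (hG : G.Connected) (D : V → ℤ) :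
    haveI : Nonempty V := hG.nonempty
    (0 ≤ rank G D ∧ ∀ ρ : V → ℕ, rank G (orderDivisor G ρ - D) = -1) ∨
      (rank G D = -1 ∧ ∃ ρ : V → ℕ, Function.Injective ρ ∧ 0 ≤ rank G (orderDivisor G ρ - D)) := by
  haveI : Nonempty V := hG.nonempty
  rcases winnable_or_exists_winnable_orderDivisor_sub hG D with h | ⟨ρ, hρ, h⟩
  · exact Or.inl ⟨(rank_nonneg_iff G D).2 h,
      fun ρ => (rank_eq_neg_one_iff G _).2 (h.not_winnable_orderDivisor_sub ρ)⟩
  · refine Or.inr ⟨(rank_eq_neg_one_iff G D).2 fun hD => hD.not_winnable_orderDivisor_sub ρ h,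
      ρ, hρ, (rank_nonneg_iff G _).2 h⟩

/-- **Corollary 3.4.** «For `D ∈ Div(G)` with `deg(D) = g − 1` we have `D ∈ 𝒩` if and only if
there exists a linear order `<_P` on `V(G)` such that `D ∼ ν_P`» («if `ν_P − D ∼ E` with
`E ≥ 0`, then `deg(E) = 0` and thus `E = 0`, so that `D ∼ ν_P`»). [cite: BakerNorine2007,
Corollary 3.4] -/
theorem not_winnable_iff_exists_linEquiv_orderDivisor (hG : G.Connected) {D : V → ℤ}
    (hdeg : ∑ v, D v = genus G - 1) :
    ¬Winnable G D ↔ ∃ ρ : V → ℕ, Function.Injective ρ ∧ LinEquiv G D (orderDivisor G ρ) := by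
  haveI : Nonempty V := hG.nonempty
  constructor
  · intro hD
    rcases winnable_or_exists_winnable_orderDivisor_sub hG D with h | ⟨ρ, hρ, E, hE, hνE⟩
    · exact absurd h hD
    · refine ⟨ρ, hρ, ?_⟩
      have hs : ∑ v, E v = 0 := by
        rw [← hνE.sum_eq]
        simp only [Pi.sub_apply, Finset.sum_sub_distrib, sum_orderDivisor G hρ, hdeg, sub_self]
      obtain rfl : E = 0 :=
        funext fun v => (Finset.sum_eq_zero_iff_of_nonneg fun v _ => hE v).1 hs v (mem_univ v)
      rw [linEquiv_iff, sub_zero] at hνE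
      exact LinEquiv.symm hνE
  · rintro ⟨ρ, -, h⟩ hW
    exact not_winnable_orderDivisor G ρ (h.winnable hW)

/-- Corollary 3.4 in terms of `r`: for `deg(D) = g − 1`, `r(D) = −1` iff `D ∼ ν_P` for some
linear order. [cite: BakerNorine2007, Corollary 3.4] -/
theorem rank_eq_neg_one_iff_exists_linEquiv_orderDivisor (hG : G.Connected) {D : V → ℤ}
    (hdeg : ∑ v, D v = genus G - 1) :
    haveI : Nonempty V := hG.nonempty
    rank G D = -1 ↔ ∃ ρ : V → ℕ, Function.Injective ρ ∧ LinEquiv G D (orderDivisor G ρ) := by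
  haveI : Nonempty V := hG.nonempty
  rw [rank_eq_neg_one_iff, not_winnable_iff_exists_linEquiv_orderDivisor hG hdeg]

/-- **Theorem 1.9 (2).** «If `N ≤ g − 1`, then there is always an initial configuration for
which no winning strategy exists» — `ν_P − E` for an effective `E` of degree `g − 1 − N`.
[cite: BakerNorine2007, Theorem 1.9 (2)] -/
theorem exists_not_winnable_of_le (hG : G.Connected) {N : ℤ} (hN : N ≤ genus G - 1) :
    ∃ D : V → ℤ, ∑ v, D v = N ∧ ¬Winnable G D := by
  haveI : Nonempty V := hG.nonempty
  obtain ⟨q⟩ := ‹Nonempty V›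
  have hρ : Function.Injective (fun v : V => ((Fintype.equivFin V) v : ℕ)) :=
    fun v w h => (Fintype.equivFin V).injective (Fin.ext h)
  refine ⟨orderDivisor G (fun v => ((Fintype.equivFin V) v : ℕ)) - Pi.single q (genus G - 1 - N),
    ?_, fun hW => ?_⟩
  · simp only [Pi.sub_apply, Finset.sum_sub_distrib, sum_orderDivisor G hρ, Finset.sum_pi_single',
      mem_univ, if_true]
    ring
  · refine not_winnable_orderDivisor G (fun v : V => ((Fintype.equivFin V) v : ℕ)) ?_
    have hc : (0 : ℤ) ≤ genus G - 1 - N := by omega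
    have hF : (0 : V → ℤ) ≤ Pi.single q (genus G - 1 - N) := fun v => by
      by_cases hv : v = q
      · subst hv
        simpa using hc
      · simp [hv]
    have h := hW.add_nonneg hF
    rwa [sub_add_cancel] at h

end MainTheorem

end Literature.Combinatorics.SimpleGraph.BakerNorine
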